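import Summits.ABC.IUTFork.Joshi.RosettaFragment3OfHol
import Mathlib.RingTheory.Polynomial.Subring
import HarnessLib

/-!
# [J-III] §8.5–§8.6 on the Fragment-1 carrier: the norm-cut `O^▷` IS the integral-closure monoid `𝒪^⊳`
# (`ATS3.OTriEqNonzeroIntegers` DISCHARGED) — PROOF-ONLY companion of `Joshi/RosettaFragment3OfHol.lean`

abc-iut cell, branch E (rung LADDER-ABC:A2.E), seat abc-iut-E-t45 (batch 3, proof-only companion file; the statement
file `Joshi/RosettaFragment3OfHol.lean`, abc-iut-E-t17, p429857, is imported BY NAME and not edited). K. Joshi,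
*Construction of Arithmetic Teichmüller Spaces III*, arXiv 2401.13508 **v4** (bib `Joshi2024ATS3`, UNREFEREED preprint,
cited as such; typed AS A CANDIDATE, D-0012; typed ≠ proved ≠ endorsed; nothing here asserts abc or [IUTchIII] Cor. 3.12).

`RosettaFragment3OfHol.lean` builds Joshi's Rosetta-Stone Fragment 3 prime-strip signature (`StripDatum.ofLocalHol H τ`,
[J-III] §8.5–§8.6, p.81–84) on the Fragment-1 carrier of `RosettaFragment1.lean` (abc-iut-E-t16): the untilt `K_v := U.K`
(a complete algebraically closed non-archimedean normed field, [J-I] §3), the preferred algebraic closure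
`L̄_{v;K_v} := algebraicClosure L_v K_v ⊂ K_v` and the local holomorphoid datum `H : Rosetta.LocalHolDatum Lv U Γ`
(field `norm_algebraMap_le_one_iff : ‖x‖_{K_v} ≤ 1 ↔ x ∈ 𝒪_{L_v}` — «`ℚ_{p_v}` (hence `L_v`) isometrically embedded»,
Prop. 8.3.1.1 (1) p.76 l.6–7), plus the supplement `τ : TateSupplement Lv U` (Tate quasi-period; `ℓ`; the
`G_{L_v;K_v}`-invariance of `‖−‖_{K_v}` on `L̄_{v;K_v}`, field `norm_gal`). It RECORDED, without asserting it, the one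
discrepancy between the two typings of the monoid of the Frobenius-like row `F` (p.82 l.13–16):
Fragment 3's NORM CUT `O^▷_{L̄_v} = {x ≠ 0, ‖x‖_{K_v} ≤ 1}` (`StripDatum.OTri`) versus Fragment 1's INTEGRAL-CLOSURE
monoid `𝒪^⊳ = (integral closure of 𝒪_{L_v} in L̄_{v;K_v}) ∖ {0}` (`Literature.AnabelianGeometry.AbsoluteAnabelian.nonzeroIntegers`,
[J-III] p.81 l.41 «`O_{L̄_v}` is the integral closure of `O_v` in `L̄_v`»; [AbsTopIII] Def. 3.1 (i)), as the untagged
dictionary `Prop` `ATS3.OTriEqNonzeroIntegers H τ`.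

THIS FILE PROVES `ATS3.OTriEqNonzeroIntegers H τ` for EVERY `H`, `τ` (`oTriEqNonzeroIntegers_holds`): no completeness or
discreteness hypothesis on `L_v` is needed beyond what the two structures already carry — the unit-ball field of `H` and the
Galois-invariance field of `τ`. Classical content (Bosch–Güntzer–Remmert, *Non-Archimedean Analysis*, 3.1.2/1), via Mathlib's
`norm_root_le_spectralValue`, `max_norm_root_eq_spectralValue`, `spectralValue_le_one_iff`:
* `⊇`: a root in `K_v` of a monic polynomial whose coefficients have norm `≤ 1` has norm `≤ 1` (ultrametric inequality);
* `⊆`: for `x ∈ L̄_{v;K_v}` with `‖x‖_{K_v} ≤ 1`, the minimal polynomial of `x` over `L_v` splits in `K_v`; each of its roots lies in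
  `L̄_{v;K_v}` with the same minimal polynomial, hence is a `Gal(L̄_{v;K_v}/L_v)`-conjugate of `x` (Mathlib
  `Normal.minpoly_eq_iff_mem_orbit`; `L̄_{v;K_v}/L_v` is normal as an algebraic closure) and so has norm `‖x‖_{K_v} ≤ 1` by
  `τ.norm_gal`; therefore every coefficient has norm `≤ 1`, i.e. lies in `𝒪_{L_v}` by `H.norm_algebraMap_le_one_iff`, and `x` is
  integral over `𝒪_{L_v}`.
The tree's `ℚ_p`-instance of the same statement is `Literature.AnabelianGeometry.AbsoluteAnabelian.PadicAlgCl.isIntegral_iff_norm_le_one`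
(there `‖−‖` on `ℚ̄_p` IS the spectral norm; here the Galois-invariance field replaces that identification).

Consequence recorded: on the Fragment-1 carrier, Fragment 3's row `F = Π^temp ↷ O^▷_{L̄_v}` (`LocalHolStripHol`) and
Fragment 1's Frobenius-like `TM`-pair `Π^temp ↷ 𝒪^⊳_{L̄_{v;K_v}}` (`LocalHolDatum.frobeniusLike … .TM`) have THE SAME underlying
monoid (`ofLocalHol_OTri_eq_nonzeroIntegers`, `localHolStripHol_O_eq_nonzeroIntegers`). This is a consistency statement about two typings of Joshi's text;
it says nothing about [IUTchIII] Cor. 3.12 and takes no side on any author. No `def … : Prop` hypothesis and no definition at all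
(theorems only; the `K`-algebra norm fed to Mathlib's spectral-value lemmas is Mathlib's own `default : AlgebraNorm K K`).
-/

noncomputable section

namespace Summit.ABC.IUTFork.Joshi.ATS3

open Polynomial
open scoped ValuativeRel
open Summit.ABC.IUTFork.Joshi.Rosetta
open Literature.AnabelianGeometry.AbsoluteAnabelian (nonzeroIntegers integersClosure)

/-! ## 1. A non-archimedean normed field `K`: roots versus coefficients of monic polynomials (BGR 3.1.2/1) -/

section Generic

variable (K : Type*) [NormedField K]

/-- Mathlib's default `K`-algebra norm on a normed field `K` (the `Inhabited (AlgebraNorm K K)` instance of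
`Mathlib.Analysis.Normed.Unbundled.AlgebraNorm`) IS the norm — the shape Mathlib's spectral-value lemmas
`norm_root_le_spectralValue` / `max_norm_root_eq_spectralValue` consume; no new definition is introduced here. [folklore] -/
theorem default_algebraNorm_apply (x : K) : (default : AlgebraNorm K K) x = ‖x‖ := rfl

/-- The norm of a normed field is power-multiplicative. [folklore] -/
theorem isPowMul_default_algebraNorm : IsPowMul (default : AlgebraNorm K K) := fun a n _ => norm_pow a n

/-- In an ultrametric normed field the norm is non-archimedean (as a function). [folklore] -/
theorem isNonarchimedean_default_algebraNorm [IsUltrametricDist K] :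
    IsNonarchimedean (default : AlgebraNorm K K) :=
  fun a b => IsUltrametricDist.isNonarchimedean_norm a b

/-- `(default : AlgebraNorm K K) 1 = 1`. [folklore] -/
theorem default_algebraNorm_one : (default : AlgebraNorm K K) 1 = 1 := norm_one

variable {K}

/-- **Roots are bounded by coefficients** (Bosch–Güntzer–Remmert 3.1.2/1 (1), ultrametric case): in an ultrametric normed
field, a root of a monic polynomial all of whose coefficients have norm `≤ 1` has norm `≤ 1`. [folklore] -/
theorem norm_le_one_of_aeval_eq_zero [IsUltrametricDist K] {P : K[X]} (hP : P.Monic)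
    (hcoeff : ∀ n : ℕ, ‖P.coeff n‖ ≤ 1) {y : K} (hy : aeval y P = 0) : ‖y‖ ≤ 1 := by
  have h : (default : AlgebraNorm K K) y ≤ spectralValue P :=
    norm_root_le_spectralValue (isPowMul_default_algebraNorm K) (isNonarchimedean_default_algebraNorm K) hP hy
  exact h.trans ((spectralValue_le_one_iff hP).2 hcoeff)

/-- **Coefficients are bounded by roots** (Bosch–Güntzer–Remmert 3.1.2/1 (2), ultrametric case): in an ultrametric normed
field, if a monic polynomial splits and all its roots have norm `≤ 1`, then all its coefficients have norm `≤ 1` (they are,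
up to sign, elementary symmetric functions of the roots). [folklore] -/
theorem norm_coeff_le_one_of_splits [IsUltrametricDist K] {P : K[X]} (hP : P.Monic) (hsplit : P.Splits)
    (hroots : ∀ y ∈ P.roots, ‖y‖ ≤ 1) (n : ℕ) : ‖P.coeff n‖ ≤ 1 := by
  classical
  have hprod : mapAlg K K P = (P.roots.map fun a => X - C a).prod := by
    rw [mapAlg_eq_map, Algebra.algebraMap_self, Polynomial.map_id]
    exact hsplit.eq_prod_roots_of_monic hP
  have heq := max_norm_root_eq_spectralValue (isPowMul_default_algebraNorm K)
    (isNonarchimedean_default_algebraNorm K) (default_algebraNorm_one K) P P.roots hprod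
  have hle : spectralValue P ≤ 1 := by
    rw [← heq]
    refine ciSup_le fun y => ?_
    split_ifs with hy
    · exact hroots y hy
    · exact zero_le_one
  exact (spectralValue_le_one_iff hP).1 hle n

end Generic

/-! ## 2. The preferred algebraic closure `L̄_{v;K_v} ⊂ K_v`: every `K_v`-root of a minimal polynomial is a conjugate -/

section Conjugates

variable {Lv : Type} [Field Lv] {Kv : Type} [Field Kv] [Algebra Lv Kv] [IsAlgClosed Kv]

/-- Every root in `K_v` of the minimal polynomial over `L_v` of an element `x ∈ L̄_{v;K_v}` is (the image in `K_v` of) a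
`Gal(L̄_{v;K_v}/L_v)`-conjugate of `x`: the root is algebraic over `L_v`, hence lies in `L̄_{v;K_v}`, has the same minimal
polynomial, and `L̄_{v;K_v}/L_v` is normal (an algebraic closure), so Mathlib's `Normal.minpoly_eq_iff_mem_orbit` applies.
[folklore] -/
theorem exists_gal_apply_eq_of_aeval_minpoly_eq_zero (x : PrefAlgClosure Lv Kv) {y : Kv}
    (hy : aeval y (minpoly Lv x) = 0) : ∃ σ : PrefGal Lv Kv, toKv Lv Kv (σ x) = y := by
  have hx : IsIntegral Lv x := (Algebra.IsAlgebraic.isAlgebraic (R := Lv) x).isIntegral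
  have hyalg : IsAlgebraic Lv y := ⟨minpoly Lv x, minpoly.ne_zero hx, hy⟩
  set r : PrefAlgClosure Lv Kv := ⟨y, mem_algebraicClosure_iff.mpr hyalg⟩ with hr
  have hry : toKv Lv Kv r = y := rfl
  have hroot : aeval r (minpoly Lv x) = 0 := by
    apply (toKv Lv Kv).toRingHom.injective
    rw [RingHom.map_zero, AlgHom.toRingHom_eq_coe, AlgHom.coe_toRingHom, ← aeval_algHom_apply, hry, hy]
  have hmin : minpoly Lv r = minpoly Lv x :=
    (minpoly.eq_of_irreducible_of_monic (minpoly.irreducible hx) hroot (minpoly.monic hx)).symm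
  haveI : IsAlgClosure Lv (PrefAlgClosure Lv Kv) := isAlgClosure_prefAlgClosure Lv Kv
  obtain ⟨σ, hσ⟩ := (Normal.minpoly_eq_iff_mem_orbit (F := Lv) (E := PrefAlgClosure Lv Kv)).mp hmin
  have hσ' : σ • x = r := hσ
  refine ⟨σ, ?_⟩
  rw [← AlgEquiv.smul_def, hσ', hry]

end Conjugates

section ConjugatesNormed

variable {Lv : Type} [Field Lv] {Kv : Type} [NormedField Kv] [Algebra Lv Kv] [IsAlgClosed Kv]

/-- If `‖−‖_{K_v}` is `Gal(L̄_{v;K_v}/L_v)`-invariant on `L̄_{v;K_v}` (the field `TateSupplement.norm_gal`), then every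
`K_v`-root of the minimal polynomial of `x ∈ L̄_{v;K_v}` has the norm of `x`. [folklore] -/
theorem norm_eq_of_aeval_minpoly_eq_zero
    (hgal : ∀ (σ : PrefGal Lv Kv) (x : PrefAlgClosure Lv Kv), ‖toKv Lv Kv (σ x)‖ = ‖toKv Lv Kv x‖)
    (x : PrefAlgClosure Lv Kv) {y : Kv} (hy : aeval y (minpoly Lv x) = 0) : ‖y‖ = ‖toKv Lv Kv x‖ := by
  obtain ⟨σ, hσ⟩ := exists_gal_apply_eq_of_aeval_minpoly_eq_zero x hy
  rw [← hσ, hgal σ x]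

end ConjugatesNormed

/-! ## 3. The discharge on the Fragment-1 carrier -/

section Discharge

variable {p : ℕ} [Fact p.Prime] {Lv : Type} [Field Lv] [ValuativeRel Lv] {U : Untilt p} [Algebra Lv U.K]
  {Γ : Type} [Group Γ] [TopologicalSpace Γ]

/-- **`𝒪^⊳ ⊆ O^▷`**: an element of `L̄_{v;K_v}` integral over `𝒪_{L_v}` has `‖−‖_{K_v} ≤ 1` — it is a root of a monic
polynomial whose coefficients lie in `𝒪_{L_v}`, i.e. have norm `≤ 1` in `K_v` (`H.norm_algebraMap_le_one_iff`), and
`K_v` is ultrametric. [folklore] -/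
theorem norm_toKv_le_one_of_isIntegral (H : LocalHolDatum Lv U Γ) {x : PrefAlgClosure Lv U.K} (hx : IsIntegral 𝒪[Lv] x) :
    ‖toKv Lv U.K x‖ ≤ 1 := by
  obtain ⟨f, hf, hfx⟩ := hx
  set g : Lv[X] := f.map (algebraMap 𝒪[Lv] Lv) with hg
  have hgm : g.Monic := hf.map _
  have hgx : aeval x g = 0 := by
    rw [hg, aeval_map_algebraMap]
    exact hfx
  set P : U.K[X] := g.map (algebraMap Lv U.K) with hPdef
  have hPm : P.Monic := hgm.map _
  have hPy : aeval (toKv Lv U.K x) P = 0 := by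
    rw [hPdef, aeval_map_algebraMap, aeval_algHom_apply, hgx, map_zero]
  have hcoef : ∀ n : ℕ, ‖P.coeff n‖ ≤ 1 := fun n => by
    rw [hPdef, coeff_map, hg, coeff_map]
    exact (H.norm_algebraMap_le_one_iff _).mpr (f.coeff n).2
  exact norm_le_one_of_aeval_eq_zero hPm hcoef hPy

/-- **`O^▷ ⊆ 𝒪^⊳`**: an element `x ∈ L̄_{v;K_v}` with `‖x‖_{K_v} ≤ 1` is integral over `𝒪_{L_v}` — all `K_v`-roots of its
minimal polynomial over `L_v` are Galois conjugates of `x` (`τ.norm_gal`: same norm `≤ 1`), so all its coefficients have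
norm `≤ 1` (`norm_coeff_le_one_of_splits`), i.e. lie in `𝒪_{L_v}` (`H.norm_algebraMap_le_one_iff`). [folklore] -/
theorem isIntegral_of_norm_toKv_le_one (H : LocalHolDatum Lv U Γ) (τ : TateSupplement Lv U)
    {x : PrefAlgClosure Lv U.K} (hx : ‖toKv Lv U.K x‖ ≤ 1) :
    IsIntegral 𝒪[Lv] x := by
  have hint : IsIntegral Lv x := (Algebra.IsAlgebraic.isAlgebraic (R := Lv) x).isIntegral
  have hm : (minpoly Lv x).Monic := minpoly.monic hint
  set P : U.K[X] := (minpoly Lv x).map (algebraMap Lv U.K) with hPdef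
  have hPm : P.Monic := hm.map _
  have hroots : ∀ y ∈ P.roots, ‖y‖ ≤ 1 := fun y hy => by
    have hy' : aeval y (minpoly Lv x) = 0 := by
      rw [← eval_map_algebraMap, ← hPdef]
      exact (mem_roots hPm.ne_zero).mp hy
    rw [norm_eq_of_aeval_minpoly_eq_zero τ.norm_gal x hy']
    exact hx
  have hPc : ∀ n : ℕ, ‖P.coeff n‖ ≤ 1 := norm_coeff_le_one_of_splits hPm (IsAlgClosed.splits P) hroots
  have hc : ∀ n : ℕ, (minpoly Lv x).coeff n ∈ 𝒪[Lv] := fun n =>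
    (H.norm_algebraMap_le_one_iff _).mp (by simpa only [hPdef, coeff_map] using hPc n)
  have hsub : (↑(minpoly Lv x).coeffs : Set Lv) ⊆ ((𝒪[Lv] : Subring Lv) : Set Lv) := by
    intro c hc'
    obtain ⟨n, -, rfl⟩ := mem_coeffs_iff.mp (Finset.mem_coe.mp hc')
    exact hc n
  refine ⟨(minpoly Lv x).toSubring _ hsub, (monic_toSubring _ _ _).mpr hm, ?_⟩
  have hmap : ((minpoly Lv x).toSubring _ hsub).map (algebraMap 𝒪[Lv] Lv) = minpoly Lv x := by
    ext n
    rw [coeff_map]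
    exact coeff_toSubring _ _ hsub
  change aeval x ((minpoly Lv x).toSubring _ hsub) = 0
  rw [← aeval_map_algebraMap Lv x, hmap, minpoly.aeval]

/-- On the Fragment-1 carrier: `x ∈ L̄_{v;K_v}` is integral over `𝒪_{L_v}` iff `‖x‖_{K_v} ≤ 1`. [folklore] -/
theorem isIntegral_iff_norm_toKv_le_one (H : LocalHolDatum Lv U Γ) (τ : TateSupplement Lv U)
    (x : PrefAlgClosure Lv U.K) :
    IsIntegral 𝒪[Lv] x ↔ ‖toKv Lv U.K x‖ ≤ 1 :=
  ⟨norm_toKv_le_one_of_isIntegral H, isIntegral_of_norm_toKv_le_one H τ⟩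

/-- On the Fragment-1 carrier: Fragment 1's ring of integers `𝒪_{L̄_{v;K_v}}` (`integersClosure`, the integral closure of
`𝒪_{L_v}`) is the closed unit ball of `‖−‖_{K_v}` in `L̄_{v;K_v}` ([J-III] p.81 l.41 «`O_{L̄_v}` is the integral closure of
`O_v` in `L̄_v`» = §8.6.1's valuation description). [folklore] -/
theorem mem_integersClosure_iff_norm_toKv_le_one (H : LocalHolDatum Lv U Γ) (τ : TateSupplement Lv U)
    (x : PrefAlgClosure Lv U.K) :
    x ∈ integersClosure Lv (PrefAlgClosure Lv U.K) ↔ ‖toKv Lv U.K x‖ ≤ 1 :=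
  isIntegral_iff_norm_toKv_le_one H τ x

/-- **DISCHARGED — `ATS3.OTriEqNonzeroIntegers H τ` holds for every Fragment-1 datum `H` and supplement `τ`:** Fragment 3's
norm cut `O^▷_{L̄_v} = {x ≠ 0, ‖x‖_{K_v} ≤ 1}` (`StripDatum.OTri` of `StripDatum.ofLocalHol H τ`) EQUALS Fragment 1's
integral-closure monoid `𝒪^⊳_{L̄_{v;K_v}}` (`nonzeroIntegers L_v L̄_{v;K_v}`). The recorded discrepancy between the two
typings of [J-III] §8.3 / §8.5–§8.6 is thereby closed in kernel; nothing about [IUTchIII] Cor. 3.12 is asserted. [folklore] -/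
theorem oTriEqNonzeroIntegers_holds (H : LocalHolDatum Lv U Γ) (τ : TateSupplement Lv U) :
    OTriEqNonzeroIntegers H τ := by
  ext x
  simp only [SetLike.mem_coe, StripDatum.mem_OTri, ofLocalHol_absL_apply]
  change _ ↔ x ∈ integersClosure Lv (PrefAlgClosure Lv U.K) ∧ x ≠ 0
  rw [mem_integersClosure_iff_norm_toKv_le_one H τ x, and_comm]

/-- The same, as an equality of submonoids of `L̄_{v;K_v}`: Fragment 3's `O^▷` (`StripDatum.OTri`) IS Fragment 1's
`𝒪^⊳` (`nonzeroIntegers`). [folklore] -/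
theorem ofLocalHol_OTri_eq_nonzeroIntegers (H : LocalHolDatum Lv U Γ) (τ : TateSupplement Lv U) :
    (StripDatum.ofLocalHol H τ).OTri = nonzeroIntegers Lv (PrefAlgClosure Lv U.K) :=
  SetLike.coe_injective (oTriEqNonzeroIntegers_holds H τ)

/-- Corollary: on the Fragment-1 carrier the monoid of Fragment 3's row `F = Π^temp_{X/L_v;K_v} ↷ O^▷_{L̄_v}`
(`LocalHolStripHol H τ`) is Fragment 1's `𝒪^⊳_{L̄_{v;K_v}}` — the monoid of the Frobenius-like `TM`-pair
(`LocalHolDatum.frobeniusLike_TM`: `P.M = ↥(nonzeroIntegers L_v L̄_{v;K_v})`). [folklore] -/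
theorem localHolStripHol_O_eq_nonzeroIntegers (H : LocalHolDatum Lv U Γ) (τ : TateSupplement Lv U) :
    (LocalHolStripHol H τ).O = ↥(nonzeroIntegers Lv (PrefAlgClosure Lv U.K)) := by
  rw [← ofLocalHol_OTri_eq_nonzeroIntegers H τ]
  rfl

end Discharge

/-! ## 4. (appended) The unit row: on the Fragment-1 carrier `𝒪^×_{L̄_{v;K_v}}` is the unit SPHERE of `‖−‖_{K_v}`, and the
units of Fragment 3's `O^▷` lie in it (rows `F^{⊢×} = G_v ↷ O^×_{L̄_v}` (8.6.2) / Fragment 1's `TCG`-pair) -/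

section Units

open Literature.AnabelianGeometry.AbsoluteAnabelian (unitSubmonoid)

variable {p : ℕ} [Fact p.Prime] {Lv : Type} [Field Lv] [ValuativeRel Lv] {U : Untilt p} [Algebra Lv U.K]
  {Γ : Type} [Group Γ] [TopologicalSpace Γ]

/-- On the Fragment-1 carrier: Fragment 1's unit group `𝒪^×_{L̄_{v;K_v}}` (`unitSubmonoid`, [AbsTopIII] Def. 3.1 (i): the
integers with an inverse among the integers; the monoid of the `TCG`-pair `Π ↷ 𝒪^×` and of Fragment 3's row `F^{⊢×} = G_v ↷
O^×_{L̄_v}`, [J-III] (8.6.2) p.84) is the unit sphere `{‖x‖_{K_v} = 1}` — both `x` and `x⁻¹` have norm `≤ 1`. The tree's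
`ℚ_p`-instance is `PadicAlgCl.mem_unitSubmonoid_iff`. [folklore] -/
theorem mem_unitSubmonoid_iff_norm_toKv_eq_one (H : LocalHolDatum Lv U Γ) (τ : TateSupplement Lv U)
    (x : PrefAlgClosure Lv U.K) : x ∈ unitSubmonoid Lv (PrefAlgClosure Lv U.K) ↔ ‖toKv Lv U.K x‖ = 1 := by
  constructor
  · rintro ⟨hx, y, hy, hxy⟩
    have h1 : ‖toKv Lv U.K x‖ ≤ 1 := (mem_integersClosure_iff_norm_toKv_le_one H τ x).mp hx
    have h2 : ‖toKv Lv U.K y‖ ≤ 1 := (mem_integersClosure_iff_norm_toKv_le_one H τ y).mp hy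
    have h12 : ‖toKv Lv U.K x‖ * ‖toKv Lv U.K y‖ = 1 := by rw [← norm_mul, ← map_mul, hxy, map_one, norm_one]
    exact le_antisymm h1 (by nlinarith [norm_nonneg (toKv Lv U.K x), norm_nonneg (toKv Lv U.K y)])
  · intro hx
    have hx0 : x ≠ 0 := fun h => zero_ne_one (by rw [h, map_zero, norm_zero] at hx; exact hx)
    refine ⟨(mem_integersClosure_iff_norm_toKv_le_one H τ x).mpr hx.le, x⁻¹,
      (mem_integersClosure_iff_norm_toKv_le_one H τ _).mpr ?_, mul_inv_cancel₀ hx0⟩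
    rw [map_inv₀, norm_inv, hx, inv_one]

/-- The units of Fragment 3's norm-cut monoid `O^▷_{L̄_v}` (the carrier of `StripDatum.stripTimes`, row `F^{⊢×}`) have
norm `1`: a unit and its inverse both have norm `≤ 1`. [folklore] -/
theorem norm_toKv_eq_one_of_units_OTri (H : LocalHolDatum Lv U Γ) (τ : TateSupplement Lv U)
    (u : ((StripDatum.ofLocalHol H τ).OTri)ˣ) : ‖toKv Lv U.K ((u : (StripDatum.ofLocalHol H τ).OTri) : PrefAlgClosure Lv U.K)‖ = 1 := by
  have h1 : ‖toKv Lv U.K ((u : (StripDatum.ofLocalHol H τ).OTri) : PrefAlgClosure Lv U.K)‖ ≤ 1 := by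
    simpa only [ofLocalHol_absL_apply] using ((u : (StripDatum.ofLocalHol H τ).OTri).2).2
  have h2 : ‖toKv Lv U.K ((↑(u⁻¹) : (StripDatum.ofLocalHol H τ).OTri) : PrefAlgClosure Lv U.K)‖ ≤ 1 := by
    simpa only [ofLocalHol_absL_apply] using ((↑(u⁻¹) : (StripDatum.ofLocalHol H τ).OTri).2).2
  have h12 : ‖toKv Lv U.K ((u : (StripDatum.ofLocalHol H τ).OTri) : PrefAlgClosure Lv U.K)‖ *
      ‖toKv Lv U.K ((↑(u⁻¹) : (StripDatum.ofLocalHol H τ).OTri) : PrefAlgClosure Lv U.K)‖ = 1 := by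
    rw [← norm_mul, ← map_mul, ← Submonoid.coe_mul, ← Units.val_mul, mul_inv_cancel, Units.val_one,
      Submonoid.coe_one, map_one, norm_one]
  exact le_antisymm h1 (by nlinarith [norm_nonneg (toKv Lv U.K ((u : (StripDatum.ofLocalHol H τ).OTri) :
    PrefAlgClosure Lv U.K)), norm_nonneg (toKv Lv U.K ((↑(u⁻¹) : (StripDatum.ofLocalHol H τ).OTri) : PrefAlgClosure Lv U.K))])

/-- Hence the units of Fragment 3's `O^▷_{L̄_v}` are elements of Fragment 1's `𝒪^×_{L̄_{v;K_v}}`: the two typings of the row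
`F^{⊢×}` / `TCG` have the same underlying unit group inside `L̄_{v;K_v}`. [folklore] -/
theorem coe_units_OTri_mem_unitSubmonoid (H : LocalHolDatum Lv U Γ) (τ : TateSupplement Lv U)
    (u : ((StripDatum.ofLocalHol H τ).OTri)ˣ) :
    ((u : (StripDatum.ofLocalHol H τ).OTri) : PrefAlgClosure Lv U.K) ∈ unitSubmonoid Lv (PrefAlgClosure Lv U.K) :=
  (mem_unitSubmonoid_iff_norm_toKv_eq_one H τ _).mpr (norm_toKv_eq_one_of_units_OTri H τ u)

end Units

end Summit.ABC.IUTFork.Joshi.ATS3
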